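import Mathlib

/-!
# Tier7/Line3/RegularCosetSum — the geometric side over ALL double cosets equals the sum over the REGULAR ones when
the singular classes carry no weight (seat t7-x1, gen 2; crit-2's record (2) on `DominantSideOfKappa`, STATUS l. 15282)

`KappaData` (Tier7/Line3/DominantSideOfKappa.lean, p677612) takes `κ : Orb → K` INJECTIVE, which holds only on the
REGULAR double cosets (κ separates the regular classes — p1's `T7SupportTwoTorusInvariant` rows 662/663; the singular
classes `κ ∈ {0, 1}` are not separated). So `Orb` there is the set of regular cosets and the `identity` field sums over
them; the real geometric side of the two-torus RTF sums over ALL double cosets. The two agree when the singular classes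
contribute `0` (the regular-support condition of the finite test function: GeometricSideStab's «singular classes
separate», row 680). This module types that passage: `tsum_subtype_eq_of_vanish` — if `f` vanishes off the set `s`,
`∑' γ : s, f γ = ∑' γ, f γ` (Mathlib's `tsum_subtype` + the indicator identity) — and `identity_of_full`, the form the
`KappaData.identity` field consumes: from the trace identity over ALL cosets and the vanishing of the finite factor on
the singular ones, the identity over the regular cosets. No summability hypothesis is needed (the `tsum` of a function
vanishing off `s` equals the `tsum` of its restriction even when neither is summable: both junk values are `0`).

Nothing here is about the real objects; the vanishing on the singular classes is a dictionary hypothesis. Nothing about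
(N) or HC_CM; §8(d): NO. Blind lane: Mathlib only; no sorry; axioms ⊆ {propext, Classical.choice, Quot.sound}.
-/

namespace Summit.Ventures.HodgeRepro2.Tier7.Line3.RegularCosetSum

/-- **a sum over a set is the sum over everything when the function vanishes off the set**:
`∑' γ : s, f γ = ∑' γ, f γ` for `f = 0` off `s` (no summability needed). -/
theorem tsum_subtype_eq_of_vanish {Orb : Type*} (s : Set Orb) (f : Orb → ℂ) (hf : ∀ γ, γ ∉ s → f γ = 0) :
    ∑' γ : s, f γ = ∑' γ, f γ := by
  rw [tsum_subtype s f]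
  congr 1
  funext γ
  by_cases h : γ ∈ s
  · exact Set.indicator_of_mem h f
  · rw [Set.indicator_of_notMem h, hf γ h]

/-- **the trace identity over the regular cosets from the identity over all cosets**: if the finite factor vanishes on
the singular classes (`¬ reg γ → b N γ = 0`), the geometric side over all of `Orb` equals the geometric side over the
regular subtype `{γ // reg γ}`, so the identity `∑'_{Orb} a γ * b N γ = ∑' π, spec N π` yields the identity over the
regular cosets — the `identity` field of `KappaData` over `Orb' = {γ // reg γ}`. -/
theorem identity_of_full {Orb Rep : Type*} (reg : Orb → Prop) (a : Orb → ℂ) (b : ℕ → Orb → ℂ)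
    (spec : ℕ → Rep → ℂ) (hsing : ∀ N γ, ¬ reg γ → b N γ = 0)
    (hid : ∀ N, ∑' γ, a γ * b N γ = ∑' π, spec N π) :
    ∀ N, ∑' γ : {γ // reg γ}, a γ * b N γ = ∑' π, spec N π := by
  intro N
  rw [← hid N]
  exact tsum_subtype_eq_of_vanish {γ | reg γ} (fun γ => a γ * b N γ)
    (fun γ hγ => by rw [hsing N γ hγ, mul_zero])

/-- the converse direction, for the record: the identity over the regular cosets gives the identity over all cosets
under the same vanishing. -/
theorem identity_full_of_regular {Orb Rep : Type*} (reg : Orb → Prop) (a : Orb → ℂ) (b : ℕ → Orb → ℂ)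
    (spec : ℕ → Rep → ℂ) (hsing : ∀ N γ, ¬ reg γ → b N γ = 0)
    (hid : ∀ N, ∑' γ : {γ // reg γ}, a γ * b N γ = ∑' π, spec N π) :
    ∀ N, ∑' γ, a γ * b N γ = ∑' π, spec N π := by
  intro N
  rw [← hid N]
  exact (tsum_subtype_eq_of_vanish {γ | reg γ} (fun γ => a γ * b N γ)
    (fun γ hγ => by rw [hsing N γ hγ, mul_zero])).symm

/-- the geometric side over all cosets is non-zero iff the one over the regular cosets is (same vanishing). -/
theorem geom_ne_zero_iff {Orb : Type*} (reg : Orb → Prop) (a : Orb → ℂ) (b : ℕ → Orb → ℂ)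
    (hsing : ∀ N γ, ¬ reg γ → b N γ = 0) (N : ℕ) :
    (∑' γ, a γ * b N γ ≠ 0) ↔ (∑' γ : {γ // reg γ}, a γ * b N γ ≠ 0) := by
  have h := tsum_subtype_eq_of_vanish {γ | reg γ} (fun γ => a γ * b N γ)
    (fun γ hγ => by rw [hsing N γ hγ, mul_zero])
  exact Iff.of_eq (congrArg (fun x => x ≠ 0) h.symm)

end Summit.Ventures.HodgeRepro2.Tier7.Line3.RegularCosetSum
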